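import Literature.MathematicalPhysics.QuantumLattice.HubbardTTPrimePhaseCoexistenceExclusion
import Literature.MathematicalPhysics.QuantumLattice.HubbardTTPrimeDiagHopTransport
import Literature.MathematicalPhysics.QuantumLattice.HubbardNNNHoppingEnergyDensityConcave
import Literature.MathematicalPhysics.QuantumLattice.HubbardNNNHoppingEnergyDensityMonotone
import HarnessLib

/-!
# Ventures/CertifiedManyBodySolver — Observables/PhaseSeparationExclusionBox.lean

HONEST FRAMING: a «competing orders» word of CONTROL class — the EXCLUSION of MACROSCOPIC PHASE SEPARATION of a
translation-invariant ground state into a phase of density `≤ n₁` and a phase of density `≥ n₂` — TRANSPORTED OVER A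
`(t′, U)` CELL of a material box from finitely many certified energy rows; every sentence is CONDITIONAL on the rows it
names; nothing is said about stripes / finite-period states (ONE density — not excluded), about `T > 0`, or about
superconductivity; no number of record is produced here. Zero compute, no definition, no claim node, no `sorry`.

Cell `pub/hubbard-downfold` (MO-S1 ↔ S2 seam, D-0150 L-DF2 «box ↦ one word»; D-0096 (iii) «competing orders»), seat
`hubbard-downfold-unc-2` (filling direction: chords / convexity in `n`), `prover-hubbard-downfold-unc-2-g19-0`. The POINT
sentence is hubbard-box-p1's (`Observables/PhaseSeparationExclusionU8.lean`, p646284, at the registry cell `(8, 7/8, 0)`;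
law `IsTranslationInvariant.energyDensityTT'_lt_meanEnergy_mix_of_cap_lt_floors_of_le` = the super-segment form of
[Israel 1979, Thm I.2.4], `Literature/…/HubbardTTPrimePhaseCoexistenceExclusion.lean`): a certified CAP `e(n) ≤ c` at the
mean density `n = a·n₁ + b·n₂` and certified FLOORS `f_i ≤ e(n_i)` with `c < a·f₁ + b·f₂` exclude every `(≤ n₁ | ≥ n₂)`
mixture. A downfolded MATERIAL arrives as a `(t′, U)` BOX, and its certified rows sit at a few stations; this file is the
transport that turns them into the sentence on a whole cell `[s₁, s₂] × [U₁, U₂]`: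
* §1 `ps_not_groundState_mix_on_cell_of_fns` — the cell sentence from a cap FUNCTION at `n` and two floor FUNCTIONS at
  `n₁, n₂`, valid on the cell, with positive margin everywhere (the law, pointwise); `ps_margin_le_meanEnergy_mix_on_cell_of_fns`
  the energy gap of the separated state.
* §2 the FAMILIES a station supplies on a cell (all `e = energyDensityTT' t …` statements, any density unless said):
  `energyDensityTT'_uchord_floor_of_mem_Icc` (two floors at `U₁ < U₂` ⇒ the `U`-CHORD is a floor on `[U₁, U₂]`, `e` concave
  in `U`, `energyDensityTT'_chord_le`, closed-interval form) · `energyDensityTT'_tchord_floor_of_mem_Icc` (the same in `t′`,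
  `concaveOn_energyDensityTT'_tPrime`) · `floor_on_cell_of_columnLaws` (two COLUMN LAWS `L_i(s) ≤ e(s, U_i)` ⇒ their
  `U`-chord floors the cell) · `floor_above_column_of_law` (a column law floors every larger `U`, Griffiths
  `energyDensityTT'_mono_U`) · `halfFilling_floor_on_cell_of_leftEdge_floors` (at `n = 1`, hole side `s₂ ≤ 0`: two NUMBERS
  at the cell's left edge floor the cell — `monotoneOn_energyDensityTT'_tPrime_one`) · `floor_on_cell_of_tPrime_end_rows`
  (two `U`-uniform rows at the `t′`-ends, e.g. kernel Fermi-sea rows, ⇒ their `t′`-chord floors the cell) ·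
  `cap_on_cell_of_top_cap` (a cap at the TOP edge `U₂`, uniform in `t′`, caps the cell).
* §3 THE COLUMN FORMS the instances use — `ps_not_groundState_mix_on_cell_of_columns`: cap AFFINE in `U` on the cell,
  floor at `n₂` by two column laws, floor at `n₁` by any function of `s`; then positivity of the two COLUMN MARGINS (each a
  function of `s` alone) gives the sentence on the whole cell (the margin is affine in `U` at fixed `s`:
  `uchord_pos_of_ends`); `ps_not_groundState_mix_above_column` the half-infinite version `U ≥ U₂` from ONE column law and a
  cap non-decreasing in `U`, checked at the far end `U₃` only.
Instances: `Downfold/BoxesLa214V115M2cPhaseSeparation.lean` (the LSCO `x = 1/8` box, `n = 7/8`, cells around `U = 8`).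
NOT said: anything at `U` outside the cells; anything about which phase IS the ground state; the quality of the sentence is
set by three window widths (cap at `n`, floors at `n₁`, `n₂`) against the true convexity defect (`≈ 0.05–0.3·t`).
References: V. J. Emery, S. A. Kivelson, H. Q. Lin, PRL 64 (1990) 475 [EmeryKivelsonLin1990]; R. B. Israel, *Convexity in the
Theory of Lattice Gases* (1979) Thm I.2.4 [Israel1979]; D. Ruelle, *Statistical Mechanics* (1969) §3.3 [Ruelle1969];
R. B. Griffiths, J. Math. Phys. 7 (1966) 1215, §II [Griffiths1966].
-/

noncomputable section

namespace Summit.Ventures.CertifiedManyBodySolver.Observables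

open Literature.MathematicalPhysics.QuantumLattice Literature.MathematicalPhysics.QuantumLattice.ThermodynamicLimit
open Literature.MathematicalPhysics.QuantumLattice.InfVolFermionState Set

/-! ## §1 The cell sentence from a cap function and two floor functions -/

/-- **PS EXCLUSION ON A CELL from three bound functions.** Cell `[s₁, s₂] × [U₁, U₂]` (`U₁ ≥ 0`), densities `n₁ < n₂`,
weights `a, b ≥ 0`, `a + b = 1`; a cap function `C` at the mean density `a n₁ + b n₂`, floor functions `F₁` at `n₁` and `F₂`
at `n₂`, all valid on the cell, with `C < a F₁ + b F₂` everywhere on the cell. Then at every `(s, U)` of the cell, every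
mixture `λω₁ + (1−λ)ω₂` (`0 < λ < 1`) of translation-invariant states of densities `0 < ρ(ω₁) ≤ n₁`, `n₂ ≤ ρ(ω₂) < 2` has mean
energy STRICTLY above `e(t, s, U, ·)` at its own density — it is not a ground state.
[cite: Israel1979, Thm. I.2.4] [cite: EmeryKivelsonLin1990, pp. 475–476] -/
theorem ps_not_groundState_mix_on_cell_of_fns (t : ℝ) {s₁ s₂ U₁ U₂ n₁ n₂ a b : ℝ} (hU₁ : 0 ≤ U₁) (hn : n₁ < n₂)
    (ha : 0 ≤ a) (hb : 0 ≤ b) (hab : a + b = 1) {C F₁ F₂ : ℝ → ℝ → ℝ}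
    (hC : ∀ s ∈ Icc s₁ s₂, ∀ U ∈ Icc U₁ U₂, energyDensityTT' t s U (a * n₁ + b * n₂) ≤ C s U)
    (hF₁ : ∀ s ∈ Icc s₁ s₂, ∀ U ∈ Icc U₁ U₂, F₁ s U ≤ energyDensityTT' t s U n₁)
    (hF₂ : ∀ s ∈ Icc s₁ s₂, ∀ U ∈ Icc U₁ U₂, F₂ s U ≤ energyDensityTT' t s U n₂)
    (hpos : ∀ s ∈ Icc s₁ s₂, ∀ U ∈ Icc U₁ U₂, C s U < a * F₁ s U + b * F₂ s U)
    {s : ℝ} (hs : s ∈ Icc s₁ s₂) {U : ℝ} (hU : U ∈ Icc U₁ U₂)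
    {ω₁ ω₂ : InfVolFermionState 2} (h₁ : ω₁.IsTranslationInvariant) (h₂ : ω₂.IsTranslationInvariant)
    (hρ₁ : 0 < ω₁.density) (hρ₁' : ω₁.density ≤ n₁) (hρ₂ : n₂ ≤ ω₂.density) (hρ₂' : ω₂.density < 2)
    {lam : ℝ} (hl0 : 0 < lam) (hl1 : lam < 1) :
    energyDensityTT' t s U (mix lam hl0.le hl1.le ω₁ ω₂).density <
      (mix lam hl0.le hl1.le ω₁ ω₂).meanEnergy (hubbardTTPrimeFermionInteraction t s U) 1 :=
  h₁.energyDensityTT'_lt_meanEnergy_mix_of_cap_lt_floors_of_le t s (hU₁.trans hU.1) h₂ hρ₁ hρ₂' hρ₁' hn hρ₂ ha hb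
    hab (hC s hs U hU) (hF₁ s hs U hU) (hF₂ s hs U hU) (hpos s hs U hU) hl0 hl1

/-- **ENERGY GAP of the separated state on a cell.** Same cell data (no positivity needed): at every `(s, U)` of the cell,
for translation-invariant `ω₁, ω₂` of densities EXACTLY `n₁, n₂` (`0 < n₁`, `n₂ < 2`) the mixture with weight `a` on `ω₁`
(density `a n₁ + b n₂`, `b = 1 − a`) lies at least `a F₁ + b F₂ − C` (evaluated at `(s, U)`) above `e` at its density.
[cite: Israel1979, Thm. I.2.4] [cite: EmeryKivelsonLin1990, pp. 475–476] -/
theorem ps_margin_le_meanEnergy_mix_on_cell_of_fns (t : ℝ) {s₁ s₂ U₁ U₂ n₁ n₂ a : ℝ} (hU₁ : 0 ≤ U₁)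
    (hn₁ : 0 < n₁) (hn₂ : n₂ < 2) (hn : n₁ < n₂) (ha0 : 0 ≤ a) (ha1 : a ≤ 1) {C F₁ F₂ : ℝ → ℝ → ℝ}
    (hC : ∀ s ∈ Icc s₁ s₂, ∀ U ∈ Icc U₁ U₂, energyDensityTT' t s U (a * n₁ + (1 - a) * n₂) ≤ C s U)
    (hF₁ : ∀ s ∈ Icc s₁ s₂, ∀ U ∈ Icc U₁ U₂, F₁ s U ≤ energyDensityTT' t s U n₁)
    (hF₂ : ∀ s ∈ Icc s₁ s₂, ∀ U ∈ Icc U₁ U₂, F₂ s U ≤ energyDensityTT' t s U n₂)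
    {s : ℝ} (hs : s ∈ Icc s₁ s₂) {U : ℝ} (hU : U ∈ Icc U₁ U₂)
    {ω₁ ω₂ : InfVolFermionState 2} (h₁ : ω₁.IsTranslationInvariant) (h₂ : ω₂.IsTranslationInvariant)
    (hρ₁ : ω₁.density = n₁) (hρ₂ : ω₂.density = n₂) :
    energyDensityTT' t s U (mix a ha0 ha1 ω₁ ω₂).density + (a * F₁ s U + (1 - a) * F₂ s U - C s U) ≤
      (mix a ha0 ha1 ω₁ ω₂).meanEnergy (hubbardTTPrimeFermionInteraction t s U) 1 := by
  have hf₁ : F₁ s U ≤ energyDensityTT' t s U ω₁.density := by rw [hρ₁]; exact hF₁ s hs U hU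
  have hf₂ : F₂ s U ≤ energyDensityTT' t s U ω₂.density := by rw [hρ₂]; exact hF₂ s hs U hU
  have hc : energyDensityTT' t s U (a * ω₁.density + (1 - a) * ω₂.density) ≤ C s U := by
    rw [hρ₁, hρ₂]; exact hC s hs U hU
  exact h₁.energyDensityTT'_add_margin_le_meanEnergy_mix t s (hU₁.trans hU.1) h₂ (by rw [hρ₁]; exact hn₁)
    (by rw [hρ₁]; linarith) (by rw [hρ₂]; linarith) (by rw [hρ₂]; exact hn₂) hf₁ hf₂ ha0 ha1 hc

/-! ## §2 The families a station supplies on a cell -/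

/-- **`U`-chord floor on a closed interval** (`e(t,t',·,n)` concave in `U`, `energyDensityTT'_chord_le`; endpoints included):
floors `L₁ ≤ e(U₁)`, `L₂ ≤ e(U₂)` (`0 ≤ U₁ < U₂`) give `((U₂ − U)L₁ + (U − U₁)L₂)/(U₂ − U₁) ≤ e(U)` for every `U ∈ [U₁, U₂]`.
[cite: Ruelle1969, §3.3] -/
theorem energyDensityTT'_uchord_floor_of_mem_Icc (t t' : ℝ) {n : ℝ} (hn0 : 0 ≤ n) (hn2 : n < 2)
    {U₁ U₂ L₁ L₂ : ℝ} (hU₁ : 0 ≤ U₁) (h12 : U₁ < U₂)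
    (hL₁ : L₁ ≤ energyDensityTT' t t' U₁ n) (hL₂ : L₂ ≤ energyDensityTT' t t' U₂ n) {U : ℝ} (hU : U ∈ Icc U₁ U₂) :
    ((U₂ - U) * L₁ + (U - U₁) * L₂) / (U₂ - U₁) ≤ energyDensityTT' t t' U n := by
  have hd : (U₂ - U₁) ≠ 0 := (sub_pos.2 h12).ne'
  rcases eq_or_lt_of_le hU.1 with h1 | h1
  · subst h1
    have e1 : ((U₂ - U₁) * L₁ + (U₁ - U₁) * L₂) / (U₂ - U₁) = L₁ := by field_simp; ring
    rw [e1]; exact hL₁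
  rcases eq_or_lt_of_le hU.2 with h2 | h2
  · subst h2
    have e2 : ((U - U) * L₁ + (U - U₁) * L₂) / (U - U₁) = L₂ := by field_simp; ring
    rw [e2]; exact hL₂
  exact energyDensityTT'_chord_le t t' hn0 hn2 hU₁ h1 h2 hL₁ hL₂

/-- **`t′`-chord floor on a closed interval** (`e(t,·,U,n)` concave in `t′`, `concaveOn_energyDensityTT'_tPrime`): floors
`f₁ ≤ e(s₁)`, `f₂ ≤ e(s₂)` (`s₁ < s₂`, `U ≥ 0`) give `((s₂ − s)f₁ + (s − s₁)f₂)/(s₂ − s₁) ≤ e(s)` for every `s ∈ [s₁, s₂]`.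
[cite: Ruelle1969, §3.3] -/
theorem energyDensityTT'_tchord_floor_of_mem_Icc (t : ℝ) {U : ℝ} (hU : 0 ≤ U) {n : ℝ} (hn0 : 0 ≤ n) (hn2 : n < 2)
    {s₁ s₂ f₁ f₂ : ℝ} (h12 : s₁ < s₂)
    (h₁ : f₁ ≤ energyDensityTT' t s₁ U n) (h₂ : f₂ ≤ energyDensityTT' t s₂ U n) {s : ℝ} (hs : s ∈ Icc s₁ s₂) :
    ((s₂ - s) * f₁ + (s - s₁) * f₂) / (s₂ - s₁) ≤ energyDensityTT' t s U n := by
  have hd : 0 < s₂ - s₁ := sub_pos.2 h12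
  set p : ℝ := (s₂ - s) / (s₂ - s₁) with hp'
  set q : ℝ := (s - s₁) / (s₂ - s₁) with hq'
  have hp : 0 ≤ p := div_nonneg (by linarith [hs.2]) hd.le
  have hq : 0 ≤ q := div_nonneg (by linarith [hs.1]) hd.le
  have hpq : p + q = 1 := by
    rw [hp', hq', ← add_div, div_eq_one_iff_eq hd.ne']
    ring
  have hc := (concaveOn_energyDensityTT'_tPrime t hU hn0 hn2).2 (mem_univ s₁) (mem_univ s₂) hp hq hpq
  simp only [smul_eq_mul] at hc
  have hsum : p * s₁ + q * s₂ = s := by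
    rw [hp', hq']; field_simp; ring
  rw [hsum] at hc
  have hchord : ((s₂ - s) * f₁ + (s - s₁) * f₂) / (s₂ - s₁) = p * f₁ + q * f₂ := by
    rw [hp', hq']; field_simp
  rw [hchord]
  have k1 := mul_le_mul_of_nonneg_left h₁ hp
  have k2 := mul_le_mul_of_nonneg_left h₂ hq
  linarith

/-- **Floor on a cell from two COLUMN LAWS** (any density `0 ≤ n < 2`): functions `L₁, L₂` with `L_i(s) ≤ e(t, s, U_i, n)`
for every `s ∈ [s₁, s₂]` (`0 ≤ U₁ < U₂`) give the `U`-chord `((U₂ − U)L₁(s) + (U − U₁)L₂(s))/(U₂ − U₁) ≤ e(t, s, U, n)` on the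
whole cell `[s₁, s₂] × [U₁, U₂]`. [cite: Ruelle1969, §3.3] -/
theorem floor_on_cell_of_columnLaws (t : ℝ) {n : ℝ} (hn0 : 0 ≤ n) (hn2 : n < 2) {s₁ s₂ U₁ U₂ : ℝ} (hU₁ : 0 ≤ U₁)
    (h12 : U₁ < U₂) {L₁ L₂ : ℝ → ℝ}
    (hL₁ : ∀ s ∈ Icc s₁ s₂, L₁ s ≤ energyDensityTT' t s U₁ n) (hL₂ : ∀ s ∈ Icc s₁ s₂, L₂ s ≤ energyDensityTT' t s U₂ n) :
    ∀ s ∈ Icc s₁ s₂, ∀ U ∈ Icc U₁ U₂,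
      ((U₂ - U) * L₁ s + (U - U₁) * L₂ s) / (U₂ - U₁) ≤ energyDensityTT' t s U n :=
  fun s hs _ hU => energyDensityTT'_uchord_floor_of_mem_Icc t s hn0 hn2 hU₁ h12 (hL₁ s hs) (hL₂ s hs) hU

/-- **A column law floors every larger coupling** (Griffiths, `energyDensityTT'_mono_U`; any density `0 ≤ n < 2`):
`L(s) ≤ e(t, s, U₂, n)` on `[s₁, s₂]` (`U₂ ≥ 0`) gives `L(s) ≤ e(t, s, U, n)` for every `U ≥ U₂`. [cite: Griffiths1966, §II] -/
theorem floor_above_column_of_law (t : ℝ) {n : ℝ} (hn0 : 0 ≤ n) (hn2 : n < 2) {s₁ s₂ U₂ : ℝ} (hU₂ : 0 ≤ U₂) {L : ℝ → ℝ}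
    (hL : ∀ s ∈ Icc s₁ s₂, L s ≤ energyDensityTT' t s U₂ n) :
    ∀ s ∈ Icc s₁ s₂, ∀ U : ℝ, U₂ ≤ U → L s ≤ energyDensityTT' t s U n :=
  fun s hs _ hU => (hL s hs).trans (energyDensityTT'_mono_U t s hn0 hn2 hU₂ hU)

/-- **Half-filling floor on a hole-doped cell from two NUMBERS at its left edge** (`s₂ ≤ 0`, `0 ≤ U₁ < U₂`): floors
`lo₁ ≤ e(t, s₁, U₁, 1)`, `lo₂ ≤ e(t, s₁, U₂, 1)` give `((U₂ − U)lo₁ + (U − U₁)lo₂)/(U₂ − U₁) ≤ e(t, s, U, 1)` on the whole cell —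
the `U`-chord at `t′ = s₁`, then `t′ ↦ e(t, t′, U, 1)` is non-decreasing on `(−∞, 0]` (even and concave,
`monotoneOn_energyDensityTT'_tPrime_one`). [cite: Ruelle1969, §3.3] [cite: LiebWuPhysicaA2003, §1 eq. (3)] -/
theorem halfFilling_floor_on_cell_of_leftEdge_floors (t : ℝ) {s₁ s₂ U₁ U₂ lo₁ lo₂ : ℝ} (hs₂ : s₂ ≤ 0) (hU₁ : 0 ≤ U₁)
    (h12 : U₁ < U₂) (hlo₁ : lo₁ ≤ energyDensityTT' t s₁ U₁ 1) (hlo₂ : lo₂ ≤ energyDensityTT' t s₁ U₂ 1) :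
    ∀ s ∈ Icc s₁ s₂, ∀ U ∈ Icc U₁ U₂, ((U₂ - U) * lo₁ + (U - U₁) * lo₂) / (U₂ - U₁) ≤ energyDensityTT' t s U 1 := by
  intro s hs U hU
  have hch := energyDensityTT'_uchord_floor_of_mem_Icc t s₁ (n := 1) zero_le_one one_lt_two hU₁ h12 hlo₁ hlo₂ hU
  have hs0 : s ≤ 0 := hs.2.trans hs₂
  have hm := monotoneOn_energyDensityTT'_tPrime_one t (hU₁.trans hU.1)
    (show s₁ ∈ Iic (0 : ℝ) from hs.1.trans hs0) (show s ∈ Iic (0 : ℝ) from hs0) hs.1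
  exact hch.trans hm

/-- **Floor on a cell from two `U`-uniform rows at the `t′`-ends** (any density `0 ≤ n < 2`; the shape of the kernel
Fermi-sea rows `S + μ·n ≤ e(1, t′, U, n)` for every `U ≥ 0`): rows `f₁ ≤ e(t, s₁, U, n)` and `f₂ ≤ e(t, s₂, U, n)` for every
`U ≥ 0` (`s₁ < s₂`) give the `t′`-chord `((s₂ − s)f₁ + (s − s₁)f₂)/(s₂ − s₁) ≤ e(t, s, U, n)` for every `s ∈ [s₁, s₂]`, `U ≥ 0`.
[cite: Ruelle1969, §3.3] [cite: LiebLoss1993, §8, Theorem 8.2] -/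
theorem floor_on_cell_of_tPrime_end_rows (t : ℝ) {n : ℝ} (hn0 : 0 ≤ n) (hn2 : n < 2) {s₁ s₂ f₁ f₂ : ℝ} (h12 : s₁ < s₂)
    (h₁ : ∀ U : ℝ, 0 ≤ U → f₁ ≤ energyDensityTT' t s₁ U n) (h₂ : ∀ U : ℝ, 0 ≤ U → f₂ ≤ energyDensityTT' t s₂ U n) :
    ∀ s ∈ Icc s₁ s₂, ∀ U : ℝ, 0 ≤ U → ((s₂ - s) * f₁ + (s - s₁) * f₂) / (s₂ - s₁) ≤ energyDensityTT' t s U n :=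
  fun _ hs U hU => energyDensityTT'_tchord_floor_of_mem_Icc t hU hn0 hn2 h12 (h₁ U hU) (h₂ U hU) hs

/-- **A cap at the top edge caps the cell** (Griffiths, any density `0 ≤ n < 2`): `e(t, s, U₂, n) ≤ K(s)` on `[s₁, s₂]`
gives `e(t, s, U, n) ≤ K(s)` for every `0 ≤ U ≤ U₂`. [cite: Griffiths1966, §II] -/
theorem cap_on_cell_of_top_cap (t : ℝ) {n : ℝ} (hn0 : 0 ≤ n) (hn2 : n < 2) {s₁ s₂ U₂ : ℝ} {K : ℝ → ℝ}
    (hK : ∀ s ∈ Icc s₁ s₂, energyDensityTT' t s U₂ n ≤ K s) :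
    ∀ s ∈ Icc s₁ s₂, ∀ U : ℝ, 0 ≤ U → U ≤ U₂ → energyDensityTT' t s U n ≤ K s :=
  fun s hs _ hU0 hU => (energyDensityTT'_mono_U t s hn0 hn2 hU0 hU).trans (hK s hs)

/-! ## §3 The column forms -/

/-- **Positivity interpolates along a chord**: `0 < g₁`, `0 < g₂`, `U₁ < U₂`, `U ∈ [U₁, U₂]` give
`0 < ((U₂ − U)g₁ + (U − U₁)g₂)/(U₂ − U₁)`. [folklore] -/
theorem uchord_pos_of_ends {U₁ U₂ U g₁ g₂ : ℝ} (h12 : U₁ < U₂) (hU : U ∈ Icc U₁ U₂) (h₁ : 0 < g₁) (h₂ : 0 < g₂) :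
    0 < ((U₂ - U) * g₁ + (U - U₁) * g₂) / (U₂ - U₁) := by
  have hd : 0 < U₂ - U₁ := sub_pos.2 h12
  refine div_pos ?_ hd
  rcases eq_or_lt_of_le hU.1 with h1 | h1
  · subst h1
    have : (U₁ - U₁) * g₂ = 0 := by ring
    rw [this, add_zero]
    exact mul_pos hd h₁
  · have k1 : 0 ≤ (U₂ - U) * g₁ := mul_nonneg (sub_nonneg.2 hU.2) h₁.le
    have k2 : 0 < (U - U₁) * g₂ := mul_pos (sub_pos.2 h1) h₂
    linarith

/-- **PS EXCLUSION ON A CELL, COLUMN FORM.** Cell `[s₁, s₂] × [U₁, U₂]` (`0 ≤ U₁ < U₂`); densities `n₁ < n₂` in `[0, 2)`,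
weights `a, b ≥ 0`, `a + b = 1`, mean density `n = a n₁ + b n₂`. DATA: a cap AFFINE in `U`, `e(t, s, U, n) ≤ c₀ + c₁·U` on
the cell; two column laws at `n₂`, `L_i(s) ≤ e(t, s, U_i, n₂)` on `[s₁, s₂]`; a floor function at `n₁`, `F₁(s) ≤ e(t, s, U, n₁)`
on the cell; and POSITIVE COLUMN MARGINS `c₀ + c₁U_i < a F₁(s) + b L_i(s)` (`i = 1, 2`) for every `s ∈ [s₁, s₂]`. THEN at
every `(s, U)` of the cell no mixture `λω₁ + (1−λ)ω₂` (`0 < λ < 1`) of translation-invariant states with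
`0 < ρ(ω₁) ≤ n₁`, `n₂ ≤ ρ(ω₂) < 2` is a ground state (the margin at `(s, U)` is the `U`-chord of the two column margins).
[cite: Israel1979, Thm. I.2.4] [cite: EmeryKivelsonLin1990, pp. 475–476] [cite: Ruelle1969, §3.3] -/
theorem ps_not_groundState_mix_on_cell_of_columns (t : ℝ) {s₁ s₂ U₁ U₂ n₁ n₂ a b c₀ c₁ : ℝ} (hU₁ : 0 ≤ U₁)
    (h12 : U₁ < U₂) (hn₁ : 0 ≤ n₁) (hn : n₁ < n₂) (hn₂ : n₂ < 2) (ha : 0 ≤ a) (hb : 0 ≤ b) (hab : a + b = 1)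
    {L₁ L₂ F₁ : ℝ → ℝ}
    (hC : ∀ s ∈ Icc s₁ s₂, ∀ U ∈ Icc U₁ U₂, energyDensityTT' t s U (a * n₁ + b * n₂) ≤ c₀ + c₁ * U)
    (hL₁ : ∀ s ∈ Icc s₁ s₂, L₁ s ≤ energyDensityTT' t s U₁ n₂) (hL₂ : ∀ s ∈ Icc s₁ s₂, L₂ s ≤ energyDensityTT' t s U₂ n₂)
    (hF₁ : ∀ s ∈ Icc s₁ s₂, ∀ U ∈ Icc U₁ U₂, F₁ s ≤ energyDensityTT' t s U n₁)
    (hm₁ : ∀ s ∈ Icc s₁ s₂, c₀ + c₁ * U₁ < a * F₁ s + b * L₁ s)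
    (hm₂ : ∀ s ∈ Icc s₁ s₂, c₀ + c₁ * U₂ < a * F₁ s + b * L₂ s)
    {s : ℝ} (hs : s ∈ Icc s₁ s₂) {U : ℝ} (hU : U ∈ Icc U₁ U₂)
    {ω₁ ω₂ : InfVolFermionState 2} (h₁ : ω₁.IsTranslationInvariant) (h₂ : ω₂.IsTranslationInvariant)
    (hρ₁ : 0 < ω₁.density) (hρ₁' : ω₁.density ≤ n₁) (hρ₂ : n₂ ≤ ω₂.density) (hρ₂' : ω₂.density < 2)
    {lam : ℝ} (hl0 : 0 < lam) (hl1 : lam < 1) :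
    energyDensityTT' t s U (mix lam hl0.le hl1.le ω₁ ω₂).density <
      (mix lam hl0.le hl1.le ω₁ ω₂).meanEnergy (hubbardTTPrimeFermionInteraction t s U) 1 := by
  have hn2' : 0 ≤ n₂ := hn₁.trans hn.le
  refine ps_not_groundState_mix_on_cell_of_fns t hU₁ hn ha hb hab (C := fun _ U => c₀ + c₁ * U)
    (F₁ := fun s _ => F₁ s) (F₂ := fun s U => ((U₂ - U) * L₁ s + (U - U₁) * L₂ s) / (U₂ - U₁)) hC hF₁
    (floor_on_cell_of_columnLaws t hn2' hn₂ hU₁ h12 hL₁ hL₂) ?_ hs hU h₁ h₂ hρ₁ hρ₁' hρ₂ hρ₂' hl0 hl1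
  intro s hs U hU
  have hpos := uchord_pos_of_ends h12 hU (sub_pos.2 (hm₁ s hs)) (sub_pos.2 (hm₂ s hs))
  have hd : (U₂ - U₁) ≠ 0 := (sub_pos.2 h12).ne'
  -- the margin at `(s, U)` is the `U`-chord of the two column margins (everything is affine in `U`)
  have hid : a * F₁ s + b * (((U₂ - U) * L₁ s + (U - U₁) * L₂ s) / (U₂ - U₁)) - (c₀ + c₁ * U) =
      ((U₂ - U) * (a * F₁ s + b * L₁ s - (c₀ + c₁ * U₁)) + (U - U₁) * (a * F₁ s + b * L₂ s - (c₀ + c₁ * U₂))) /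
        (U₂ - U₁) := by
    field_simp
    ring
  have h := hid ▸ hpos
  linarith

/-- **PS EXCLUSION ABOVE A COLUMN.** For `U ∈ [U₂, U₃]` (`U₂ ≥ 0`): a cap `e(t, s, U, n) ≤ c₀ + c₁·U` on
`[s₁, s₂] × [U₂, U₃]` with `c₁ ≥ 0`, ONE column law `L(s) ≤ e(t, s, U₂, n₂)` (it floors every `U ≥ U₂`), a floor function
`F₁(s) ≤ e(t, s, U, n₁)` on the cell, and the margin positive at the FAR end, `c₀ + c₁U₃ < a F₁(s) + b L(s)` for every `s`:
then the `(≤ n₁ | ≥ n₂)` mixtures are excluded on the whole cell (the margin is non-increasing in `U`).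
[cite: Israel1979, Thm. I.2.4] [cite: Griffiths1966, §II] -/
theorem ps_not_groundState_mix_above_column (t : ℝ) {s₁ s₂ U₂ U₃ n₁ n₂ a b c₀ c₁ : ℝ} (hU₂ : 0 ≤ U₂)
    (hc₁ : 0 ≤ c₁) (hn₁ : 0 ≤ n₁) (hn : n₁ < n₂) (hn₂ : n₂ < 2) (ha : 0 ≤ a) (hb : 0 ≤ b) (hab : a + b = 1)
    {L F₁ : ℝ → ℝ}
    (hC : ∀ s ∈ Icc s₁ s₂, ∀ U ∈ Icc U₂ U₃, energyDensityTT' t s U (a * n₁ + b * n₂) ≤ c₀ + c₁ * U)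
    (hL : ∀ s ∈ Icc s₁ s₂, L s ≤ energyDensityTT' t s U₂ n₂)
    (hF₁ : ∀ s ∈ Icc s₁ s₂, ∀ U ∈ Icc U₂ U₃, F₁ s ≤ energyDensityTT' t s U n₁)
    (hm : ∀ s ∈ Icc s₁ s₂, c₀ + c₁ * U₃ < a * F₁ s + b * L s)
    {s : ℝ} (hs : s ∈ Icc s₁ s₂) {U : ℝ} (hU : U ∈ Icc U₂ U₃)
    {ω₁ ω₂ : InfVolFermionState 2} (h₁ : ω₁.IsTranslationInvariant) (h₂ : ω₂.IsTranslationInvariant)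
    (hρ₁ : 0 < ω₁.density) (hρ₁' : ω₁.density ≤ n₁) (hρ₂ : n₂ ≤ ω₂.density) (hρ₂' : ω₂.density < 2)
    {lam : ℝ} (hl0 : 0 < lam) (hl1 : lam < 1) :
    energyDensityTT' t s U (mix lam hl0.le hl1.le ω₁ ω₂).density <
      (mix lam hl0.le hl1.le ω₁ ω₂).meanEnergy (hubbardTTPrimeFermionInteraction t s U) 1 := by
  have hn2' : 0 ≤ n₂ := hn₁.trans hn.le
  refine ps_not_groundState_mix_on_cell_of_fns t hU₂ hn ha hb hab (C := fun _ U => c₀ + c₁ * U)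
    (F₁ := fun s _ => F₁ s) (F₂ := fun s _ => L s) hC hF₁
    (fun s hs U hU => floor_above_column_of_law t hn2' hn₂ hU₂ hL s hs U hU.1) ?_ hs hU h₁ h₂ hρ₁ hρ₁' hρ₂ hρ₂'
    hl0 hl1
  intro s hs U hU
  have k := mul_le_mul_of_nonneg_left hU.2 hc₁
  have := hm s hs
  show c₀ + c₁ * U < a * F₁ s + b * L s
  linarith

end Summit.Ventures.CertifiedManyBodySolver.Observables
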